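import Summits.Ventures.HodgeRepro2.T6A2WeilGrading
import Summits.Ventures.HodgeRepro2.T6InterfaceToy

/-!
# T6A2WeilPsi — the even-part retraction `ψ`, the integral and the degree of the Pontryagin product on the host

Cell pub-hodge-repro2, Tier 6 (README §10), seat t6-p2 (A2 host side; continues T6A2WeilGrading). The
`ψ`-fields of the A2 glue's `IdentBB'` (T6A3ShadowFix l. 39: `ψ : HB K →ₗ[ℚ] H^{even}(B)`, `ψ_ev`,
`ev_ψ_even`, `ψ_odd`, `int_deg`, `int_ne_zero`, `pont_deg`) on the host Weil cohomology:
* `fullToEven W P : FullRing W P →ₗ[ℚ] EvenRing W P` — the projection onto the even degrees (degree `2i`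
  ↦ `i`, odd degrees ↦ `0`), a retraction of `evenToFull`;
* `psiOf := fullToEven ∘ evF⁻¹`, with `psiOf_evOf` (`ψ ∘ ev = id`), `evOf_psiOf_even` (`ev ∘ ψ = id` on
  even degrees), `psiOf_odd`;
* the integral: `integral_psiOf_of_ne` (`∫_B` kills the even degrees `≠ 24`, from the degree of the trace,
  `dim B = 12`) and `exists_integral_psiOf_ne_zero` (`∫_B ≠ 0` on the top degree, from the host's
  `bijective_trace`);
* `gysin_eq_push` (the Gysin map of the Weil cycle theory IS the adjoint push-forward `push`, since `PD = id`
  there) and `pont_deg_weil` (`deg (a ⋆ b) = deg a + deg b − 24`, from `push_ofDeg_eq` / `push_ofDeg_eq_zero`).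
No `sorry`; standard axioms. §8(d): uses an L-value-free non-vanishing device: NO.
-/

noncomputable section

namespace Summit.Ventures.HodgeRepro2.T6.WeilInst

open HostAPI.Carriers.AlgebraicGeometry.Motives CategoryTheory Opposite
open Summit.Ventures.HodgeRepro2.T6 Summit.Ventures.HodgeRepro2.T6.A2Gysin
  Summit.Ventures.HodgeRepro2.T6.A2Shadow
open scoped DirectSum

universe u

variable {k : Type u} [Field k] (W : WeilCohomology k ℚ)

section fullToEven

variable (P : SPVar k)

/-- `ofDeg` along an equality of (doubled) degrees -/
theorem ofDeg_castDeg {i i' : ℕ} (h : 2 * i = 2 * i') (a : Ev W P.X i) :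
    ofDeg W P i' (castDeg W h a) = ofDeg W P i a := by
  have : i = i' := by omega
  subst this; rfl

/-- THE PROJECTION ONTO THE EVEN DEGREES: degree `2 i` ↦ degree `i` of the even ring, odd degrees ↦ `0`. -/
def fullToEven : FullRing W P →ₗ[ℚ] EvenRing W P :=
  DirectSum.toModule ℚ ℕ (EvenRing W P) fun j =>
    if hj : j % 2 = 0 then (ofDeg W P (j / 2)) ∘ₗ (castDeg W (by omega : j = 2 * (j / 2))).toLinearMap else 0

/-- `fullToEven` on an even-degree class -/
theorem fullToEven_ofDegF_even (i : ℕ) (a : W.obj P.X (2 * i)) :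
    fullToEven W P (ofDegF W P (2 * i) a) = ofDeg W P i a := by
  simp only [fullToEven, ofDegF, DirectSum.toModule_lof]
  rw [dif_pos (by omega : (2 * i) % 2 = 0)]
  exact ofDeg_castDeg W P _ a

/-- `fullToEven` kills an odd-degree class -/
theorem fullToEven_ofDegF_odd (i : ℕ) (a : W.obj P.X (2 * i + 1)) :
    fullToEven W P (ofDegF W P (2 * i + 1) a) = 0 := by
  simp only [fullToEven, ofDegF, DirectSum.toModule_lof]
  rw [dif_neg (by omega : ¬ (2 * i + 1) % 2 = 0)]
  rfl

/-- `fullToEven` retracts `evenToFull` -/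
theorem fullToEven_evenToFull (x : EvenRing W P) : fullToEven W P (evenToFull W P x) = x := by
  induction x using DirectSum.induction_on with
  | zero => simp
  | of i a =>
    rw [← DirectSum.lof_eq_of ℚ]
    change fullToEven W P (evenToFull W P (ofDeg W P i a)) = ofDeg W P i a
    rw [evenToFull_ofDeg, fullToEven_ofDegF_even]
  | add x y hx hy => rw [map_add, map_add, hx, hy]

/-- `evenToFull ∘ fullToEven = id` on even-degree classes -/
theorem evenToFull_fullToEven_of_mem {i : ℕ} {y : FullRing W P} (hy : y ∈ LinearMap.range (ofDegF W P (2 * i))) :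
    evenToFull W P (fullToEven W P y) = y := by
  obtain ⟨a, rfl⟩ := hy
  rw [fullToEven_ofDegF_even, evenToFull_ofDeg]

end fullToEven

section psi

variable {K : Type*} [Field K] [NumberField K] (D : SituationData k) (A : OrderAction W D.B K)
  (hL : Function.Bijective (langeMap W D.B))

/-- THE EVEN-PART RETRACTION `ψ : HB K → H^{even}(B, ℚ)` of `ev`: `fullToEven ∘ evF⁻¹`. -/
def psiOf : HB K →ₗ[ℚ] EvenRing W D.B :=
  (fullToEven W D.B) ∘ₗ (evF W D A hL).symm.toLinearMap

/-- `ψ`, unfolded -/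
theorem psiOf_apply (u : HB K) : psiOf W D A hL u = fullToEven W D.B ((evF W D A hL).symm u) := rfl

/-- `ψ ∘ ev = id` -/
theorem psiOf_evOf (a : EvenRing W D.B) : psiOf W D A hL (evOf W D A hL a) = a := by
  rw [psiOf_apply, evOf_eq_evF, AlgEquiv.symm_apply_apply, fullToEven_evenToFull]

/-- `ev ∘ ψ = id` on even degrees -/
theorem evOf_psiOf_even (j : ℕ) (u : HB K) (hu : u ∈ degB K (2 * j)) :
    evOf W D A hL (psiOf W D A hL u) = u := by
  rw [psiOf_apply, evOf_eq_evF, evenToFull_fullToEven_of_mem W D.B (evF_symm_mem_range_ofDegF W D A hL hu),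
    AlgEquiv.apply_symm_apply]

/-- `ψ` kills the odd degrees -/
theorem psiOf_odd (j : ℕ) (u : HB K) (hu : u ∈ degB K (2 * j + 1)) : psiOf W D A hL u = 0 := by
  rw [psiOf_apply]
  obtain ⟨a, ha⟩ := evF_symm_mem_range_ofDegF W D A hL hu
  rw [← ha, fullToEven_ofDegF_odd]

/-- `∫_B ∘ ψ` kills the even degrees `≠ 24` (`dim B = 12`) -/
theorem integral_psiOf_of_ne (hdim : D.B.n = 12) (j : ℕ) (hj : j ≠ 12) (u : HB K) (hu : u ∈ degB K (2 * j)) :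
    integral W D.B (psiOf W D A hL u) = 0 := by
  rw [psiOf_apply]
  obtain ⟨a, ha⟩ := evF_symm_mem_range_ofDegF W D A hL hu
  rw [← ha, fullToEven_ofDegF_even, integral_ofDeg_of_ne W D.B (by omega)]

/-- `∫_B ∘ ψ ≠ 0` on the top degree (`dim B = 12`; the host's trace is bijective) -/
theorem exists_integral_psiOf_ne_zero (F : FaceSetting K) (hdim : D.B.n = 12) :
    ∃ u ∈ degB K 24, integral W D.B (psiOf W D A hL u) ≠ 0 := by
  obtain ⟨u, hu, hne⟩ := Toy.intB_ne_zero F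
  have hu0 : u ≠ 0 := fun h => hne (by rw [h, map_zero])
  refine ⟨u, hu, ?_⟩
  rw [psiOf_apply]
  obtain ⟨a, ha⟩ := evF_symm_mem_range_ofDegF W D A hL (show u ∈ degB K (2 * 12) from hu)
  rw [← ha, fullToEven_ofDegF_even]
  have ha0 : a ≠ 0 := by
    rintro rfl
    rw [map_zero] at ha
    exact hu0 ((evF W D A hL).symm.injective (by rw [← ha, map_zero]))
  have hint : integral W D.B (ofDeg W D.B 12 a) = W.trace D.B.X D.B.n (castDeg W (by omega : 2 * 12 = 2 * D.B.n) a) := by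
    rw [← ofDeg_castDeg W D.B (by omega : 2 * 12 = 2 * D.B.n) a, integral_ofDeg_top]
  rw [hint]
  intro h0
  have hinj := (W.bijective_trace D.B.smooth).1
  have : castDeg W (by omega : 2 * 12 = 2 * D.B.n) a = 0 := hinj (by rw [h0, map_zero])
  exact ha0 ((castDeg W _).injective (by rw [this, map_zero]))

end psi

section gysin

variable {ι : Type u} (S : ι → SPVar k) (hgen : ∀ a, HasGen (S a)) (hpush : PushAlg W S hgen)

/-- Poincaré duality is the identity in the Weil cycle theory (`cap = cup`, `mu = 1`) -/
theorem pdEquiv_apply_weil (hPD : (cycleTheory W S hgen hpush).PoincareDuality) (a : ι)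
    (x : (cycleTheory W S hgen hpush).H a) : (cycleTheory W S hgen hpush).pdEquiv hPD a x = x :=
  mul_one x

/-- THE GYSIN MAP OF THE WEIL CYCLE THEORY IS THE PUSH-FORWARD `push` (`PD = id`). -/
theorem gysin_eq_push (hPD : (cycleTheory W S hgen hpush).PoincareDuality) {a b : ι}
    (g : (S a).X ⟶ (S b).X) (x : EvenRing W (S a)) :
    (cycleTheory W S hgen hpush).gysin hPD g x = push W g x := by
  simp only [CycleTheory.gysin, LinearMap.comp_apply, LinearEquiv.coe_coe]
  rw [LinearEquiv.symm_apply_eq, pdEquiv_apply_weil, pdEquiv_apply_weil]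
  rfl

end gysin

section pontDeg

variable {K : Type*} [Field K] [NumberField K] (D : SituationData k) (hgen : D.HasGens) (hten : D.ProductsSmooth)
  (A : OrderAction W D.B K) (hL : Function.Bijective (langeMap W D.B))

/-- the Pontryagin product of the situation on the host is `m_* (pr₁^* a ∪ pr₂^* b)` with `m_* = push` -/
theorem pont_eq_push (hPD : (D.cycleTheory W hgen hten).PoincareDuality) (a b : EvenRing W D.B) :
    (D.situation W hgen hten).pont hPD a b =
      push W (P := D.BB) (Q := D.B) D.m (pull W (P := D.BB) (Q := D.B) (CartesianMonoidalCategory.fst D.B.X D.B.X) a *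
        pull W (P := D.BB) (Q := D.B) (CartesianMonoidalCategory.snd D.B.X D.B.X) b) := by
  show (D.cycleTheory W hgen hten).gysin hPD (X := ⟨2⟩) (Y := ⟨1⟩) D.m
    (pull W (P := D.BB) (Q := D.B) (CartesianMonoidalCategory.fst D.B.X D.B.X) a *
      pull W (P := D.BB) (Q := D.B) (CartesianMonoidalCategory.snd D.B.X D.B.X) b) = _
  exact gysin_eq_push W D.spaces hgen (pushAlg_of_tensor W D.spaces hgen hten) hPD (a := ⟨2⟩) (b := ⟨1⟩) D.m _

/-- THE DEGREE OF THE PONTRYAGIN PRODUCT: `deg (a ⋆ b) = deg a + deg b − 24` (`dim B = 12`), read through `ev`. -/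
theorem pont_deg_weil (hdim : D.B.n = 12) (hPD : (D.cycleTheory W hgen hten).PoincareDuality)
    (k' l : ℕ) (a b : EvenRing W D.B) (ha : evOf W D A hL a ∈ degB K (2 * k'))
    (hb : evOf W D A hL b ∈ degB K (2 * l)) :
    evOf W D A hL ((D.situation W hgen hten).pont hPD a b) ∈ degB K (2 * (k' + l - 12)) := by
  obtain ⟨a', rfl⟩ := exists_eq_ofDeg_of_evOf_mem W D A hL ha
  obtain ⟨b', rfl⟩ := exists_eq_ofDeg_of_evOf_mem W D A hL hb
  rw [pont_eq_push, pull_ofDeg, pull_ofDeg, ofDeg_mul_ofDeg]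
  have hBB : D.BB.n = D.B.n + D.B.n := rfl
  by_cases h : D.BB.n ≤ k' + l + D.B.n
  · rw [push_ofDeg_eq W (P := D.BB) (Q := D.B) D.m _ h, evOf_eq_evF, evenToFull_ofDeg]
    have hq : k' + l + D.B.n - D.BB.n = k' + l - 12 := by omega
    rw [hq] at *
    exact evF_ofDegF_mem_degB W D A hL _ _
  · rw [push_ofDeg_eq_zero W (P := D.BB) (Q := D.B) D.m _ (by omega), map_zero]
    exact Submodule.zero_mem _

end pontDeg

end Summit.Ventures.HodgeRepro2.T6.WeilInst

end
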